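import Literature.Analysis.FluidPDE.NSRobustnessOfRegularitySupNorm
import Literature.Analysis.FluidPDE.ClassicalL2StabilityStrain
import Literature.Analysis.FluidPDE.TaoQuantitativeClass
import Literature.Analysis.FluidPDE.NSTaoClassOfSobolevDatum
import Literature.Analysis.FluidPDE.TaoLocalisationProofs
import Summits.NavierStokesRegularity.FluidComputer.ClayEvolutionAprioriContinuation

/-!
# THE STRAIN-SHADOWED RUN IN `H²` CURRENCY (route (B)): existence + sup-closeness next to a forced reference,
# fee `e^{(Λ₁+Λ₂)/4}` in STRAIN TIMES, defects through fourth roots, NO `h^{-3/4}` terminal-smoothing loss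

Cell `ns-blowup`, seat `ns-palasek-20303-p1` (LEAD prover on stmt-NavierStokesRegularity-20303 `EpisodeBaseT`; line
`straindoor` at `tuned`). LABEL: E–C typing + kernel analysis (theorems only; no definition, no named fact, no `sorry`).
WHAT THIS IS NOT: not Navier–Stokes evidence — existence-and-closeness next to a GIVEN forced run on a FIXED slab.

The route-(A) door (`StrainShadowSharp.exists_freeRun_near_of_strain`, p529071) pays `h^{-3/4}` for the `L² → L^∞`
smoothing (`L²` is supercritical; twenty digits at `tuned`, `StrainDoor.RawCertificateData.defect_budget_tuned`, p532337).
ns-blowup-lit g17's `H¹/H²` robustness vein in STRAIN form (`NSRobustnessOfRegularity{,H2,SupNorm}`, RRS 2016 Thm 9.1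
/ Dashti–Robinson 2008) reads the sup distance off Agmon and has no such loss: the packaged A-PRIORI door
`classicalNS_norm_sub_le_strain_window_half_R3` (p534557) gives `‖v − w‖ ≤ A (6X₁e^{Λ₂}(D₂+Ψ₂))^{1/4}`, `A = agmonConst`,
`Λ₁ = ∫(4G+3κσ₂)`, `Λ₂ = ∫(6G+9κσ₂+3κ²σ₃+3A²X₁/μ+27A⁴X₁²/16)`, `G` the maximal COMPRESSION rate of the reference.
THIS FILE is the EXISTENCE half, as p526708/p529071 are for route (A): `freeRun_near_of_strainH2` (every free run from
`U` on a sub-slab stays `δ`-close: Tao class of the free run, the `L²` stage `l2_stability_strain_forced` feeding `L`, the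
a-priori door on `[0, s]` with its hypotheses restricted / monotone in `s`; NO bootstrap — the `H²` estimate asks no
sup bound of the free run) and **`exists_freeRun_near_of_strainH2`** (`‖v‖ ≤ B_w + δ` a priori ⟹ existence on `[0,T]` by
`ClayEvolution.exists_classical_Icc_of_apriori_bound`). It plugs into the line through
`StrainDoor.episodeBaseGAt_of_mechanismDoorAt_of_nearFreeRun` (p530553). `agmonConst` is NOT numeric today; the certificate
twin waits for the `agmonConst ↦ √2/π` re-thread of the vein (19179-p2 g6's explicit Agmon) — asked by name.

References: [cite: RobinsonRodrigoSadowskiCUP2016, Thm 9.1 and Thm 1.20]; [cite: DashtiRobinson2008, Thm 1, Thm 2];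
[cite: Tao2011, Thm. 5.4 (ii)+(iv)]; [cite: Palasek2026ElementaryModel, §4].
-/

noncomputable section

namespace Summit.NavierStokesRegularity.FluidComputer.PalasekTowerClayBridge.StrainShadowH2

open Set MeasureTheory Filter Topology Function InnerProductSpace
open scoped ENNReal NNReal ContDiff RealInnerProductSpace
open Literature.Analysis Literature.Analysis.FluidPDE

/-- A smooth compactly supported field on `ℝ³` is rapidly decaying (Fefferman's (4)).
[cite: FeffermanClay2006, (4)] -/
private theorem hasRapidSpatialDecay_of_hasCompactSupport
    {φ : EuclideanSpace ℝ (Fin 3) → EuclideanSpace ℝ (Fin 3)} (hsm : ContDiff ℝ ∞ φ)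
    (hc : HasCompactSupport φ) : HasRapidSpatialDecay φ := by
  intro n K
  have hcont : Continuous fun x => (1 + ‖x‖) ^ K * ‖iteratedFDeriv ℝ n φ x‖ :=
    ((continuous_const.add continuous_norm).pow K).mul
      (hsm.continuous_iteratedFDeriv (m := n) (mod_cast le_top)).norm
  have hsupp : HasCompactSupport fun x => (1 + ‖x‖) ^ K * ‖iteratedFDeriv ℝ n φ x‖ :=
    ((hc.iteratedFDeriv n).norm).mul_left
  obtain ⟨C, hC⟩ := hcont.bounded_above_of_compact_support hsupp
  exact ⟨C, fun x => by have h := hC x; rwa [Real.norm_eq_abs, abs_of_nonneg (by positivity)] at h⟩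

/-- From `∫⁻ ‖f‖ₑ² ≤ C` to `eLpNorm f 2 ≤ √C`. (Plumbing.) [folklore] -/
private theorem eLpNorm_le_sqrt_of_lintegral_sq_le {G : Type*} [NormedAddCommGroup G]
    {f : EuclideanSpace ℝ (Fin 3) → G} {C : ℝ≥0} (h : ∫⁻ x, ‖f x‖ₑ ^ 2 ≤ C) :
    eLpNorm f 2 volume ≤ (NNReal.sqrt C : ℝ≥0∞) := by
  rw [lintegral_enorm_sq_eq_eLpNorm_two_sq] at h
  have h2 : eLpNorm f 2 volume = (eLpNorm f 2 volume ^ 2) ^ (1 / 2 : ℝ) := by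
    rw [← ENNReal.rpow_natCast, ← ENNReal.rpow_mul]; norm_num
  rw [h2]
  calc (eLpNorm f 2 volume ^ 2) ^ (1 / 2 : ℝ) ≤ (C : ℝ≥0∞) ^ (1 / 2 : ℝ) :=
        ENNReal.rpow_le_rpow h (by norm_num)
    _ = (NNReal.sqrt C : ℝ≥0∞) := by
        rw [NNReal.sqrt_eq_rpow, ENNReal.coe_rpow_of_nonneg _ (by norm_num)]

section Main

variable {T Bw E₀ κ μ D₁ Ψ₁ D₂ Ψ₂ δ : ℝ}
  {w r : ℝ → EuclideanSpace ℝ (Fin 3) → EuclideanSpace ℝ (Fin 3)}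
  {ϖ : ℝ → EuclideanSpace ℝ (Fin 3) → ℝ} {G σ₂ σ₃ Rr L H₁ ψ₁ ψ₂ X₁ : ℝ → ℝ}
  {U : EuclideanSpace ℝ (Fin 3) → EuclideanSpace ℝ (Fin 3)}

/-- **A-PRIORI HALF: every free run from `U` on a sub-slab `[0, s] ⊆ [0, T]` stays `δ`-close to the reference**
(the `L²` stage `l2_stability_strain_forced` feeds `L`; then lit g17's packaged `H²` door
`classicalNS_norm_sub_le_strain_window_half_R3` on `[0, s]`, whose hypotheses are the restrictions / `s`-monotone
consequences of those on `[0, T]`; NO sup bound of the free run is needed). [cite: RobinsonRodrigoSadowskiCUP2016, Thm 9.1 and Thm 1.20]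
[cite: DashtiRobinson2008, Thm 1, Thm 2] [cite: Tao2011, Thm. 5.4 (ii)+(iv)] -/
theorem freeRun_near_of_strainH2 (hT : 0 < T)
    (hw : IsClassicalNSSolutionOn (Icc 0 T) 1 r w ϖ)
    (hwS : HasBoundedSobolevNormsOn (Icc 0 T) w)
    (hwt : HasBoundedSobolevNormsOn (Icc 0 T) (FluidPDE.timeDerivWithin (Icc 0 T) w))
    (hϖS : ∀ n : ℕ, ∃ C' : ℝ≥0, ∀ t ∈ Icc 0 T, ∫⁻ x, ‖iteratedFDeriv ℝ n (ϖ t) x‖ₑ ^ 2 ≤ C')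
    (hrL2 : ∀ t ∈ Icc 0 T, ∫⁻ x, ‖r t x‖ₑ ^ 2 < ⊤)
    (hrD : ∀ t ∈ Icc 0 T, ∫⁻ x, ‖fderiv ℝ (r t) x‖ₑ ^ 2 < ⊤)
    (hκ : 0 < κ) (hμ : 0 < μ)
    (hG : ∀ s ∈ Icc 0 T, ∀ (x ξ : EuclideanSpace ℝ (Fin 3)), -⟪fderiv ℝ (w s) x ξ, ξ⟫ ≤ G s * ‖ξ‖ ^ 2)
    (hG0 : ∀ s ∈ Icc 0 T, 0 ≤ G s)
    (hσ₂ : ∀ s ∈ Icc 0 T, ∀ x, ‖iteratedFDeriv ℝ 2 (w s) x‖ ≤ σ₂ s)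
    (hσ₃ : ∀ s ∈ Icc 0 T, ∀ x, ‖iteratedFDeriv ℝ 3 (w s) x‖ ≤ σ₃ s)
    (hRr0 : ∀ s ∈ Icc 0 T, 0 ≤ Rr s) (hRr : ∀ s ∈ Icc 0 T, ∫ x, ‖r s x‖ ^ 2 ≤ Rr s ^ 2)
    (hLdef : ∀ s ∈ Icc 0 T, (E₀ + ∫ τ in (0 : ℝ)..s, Rr τ) * Real.exp (∫ τ in (0 : ℝ)..s, G τ) ≤ L s)
    (hH₁ : ∀ s ∈ Icc 0 T, ∫ x, ‖fderiv ℝ (fun y => r s y - (0 : EuclideanSpace ℝ (Fin 3))) x‖ ^ 2 ≤ H₁ s)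
    (hψ₁ : ∀ s ∈ Icc 0 T, 2 / 1 * (∫ x, ‖r s x - (0 : EuclideanSpace ℝ (Fin 3))‖ ^ 2) +
      3 * σ₂ s / κ * L s ^ 2 ≤ ψ₁ s)
    (hψ₂ : ∀ s ∈ Icc 0 T, 27 * σ₂ s / κ * X₁ s + 9 * σ₃ s / κ ^ 2 * L s ^ 2 + 6 / 1 * H₁ s ≤ ψ₂ s)
    (hGc : ContinuousOn G (Icc 0 T)) (hσ₂c : ContinuousOn σ₂ (Icc 0 T)) (hσ₃c : ContinuousOn σ₃ (Icc 0 T))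
    (hRrc : ContinuousOn Rr (Icc 0 T)) (hLc : ContinuousOn L (Icc 0 T)) (hX₁c : ContinuousOn X₁ (Icc 0 T))
    (hH₁c : ContinuousOn H₁ (Icc 0 T)) (hψ₁c : ContinuousOn ψ₁ (Icc 0 T)) (hψ₂c : ContinuousOn ψ₂ (Icc 0 T))
    (hU : ContDiff ℝ ∞ U) (hUc : HasCompactSupport U)
    (hE₀ : 0 ≤ E₀) (hE0 : ∫ x, ‖U x - w 0 x‖ ^ 2 ≤ E₀ ^ 2)
    (hD₁ : ∫ x, frobeniusNormSq (fderiv ℝ (fun y => U y - w 0 y) x) ≤ D₁)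
    (hD₂ : (∑ i, ∫ x, frobeniusNormSq (fderiv ℝ (fun y => fderiv ℝ (fun z => U z - w 0 z) y
      (EuclideanSpace.basisFun (Fin 3) ℝ i)) x)) ≤ D₂)
    (hΨ₁ : ∫ s in (0 : ℝ)..T, ψ₁ s ≤ Ψ₁) (hΨ₂ : ∫ s in (0 : ℝ)..T, ψ₂ s ≤ Ψ₂)
    (hhalf₁ : 2 * (agmonConst ^ 4 / (2 * (1 : ℝ) ^ 3) *
        Real.exp (2 * ∫ s in (0 : ℝ)..T, (4 * G s + 3 * κ * σ₂ s))) * (D₁ + Ψ₁) ^ 2 * (T - 0) ≤ 1 / 2)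
    (hX₁ : ∀ s ∈ Icc 0 T,
      Real.sqrt 2 * (Real.exp (∫ τ in (0 : ℝ)..s, (4 * G τ + 3 * κ * σ₂ τ)) * (D₁ + Ψ₁)) ≤ X₁ s)
    (hhalf₂ : agmonConst ^ 2 * μ / 1 *
        Real.exp (∫ s in (0 : ℝ)..T, (6 * G s + 9 * κ * σ₂ s + 3 * κ ^ 2 * σ₃ s +
          3 * agmonConst ^ 2 * X₁ s / (1 * μ) + 27 * agmonConst ^ 4 * X₁ s ^ 2 / (16 * (1 : ℝ) ^ 3))) *
      (D₂ + Ψ₂) * (T - 0) ≤ 1 / 2)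
    (hδ : ∀ t ∈ Icc 0 T, agmonConst * (3 * X₁ t *
      (2 * (Real.exp (∫ s in (0 : ℝ)..t, (6 * G s + 9 * κ * σ₂ s + 3 * κ ^ 2 * σ₃ s +
          3 * agmonConst ^ 2 * X₁ s / (1 * μ) + 27 * agmonConst ^ 4 * X₁ s ^ 2 / (16 * (1 : ℝ) ^ 3))) *
        (D₂ + Ψ₂)))) ^ (1 / 4 : ℝ) ≤ δ)
    {s : ℝ} (hs0 : 0 < s) (hsT : s ≤ T)
    {v : ℝ → EuclideanSpace ℝ (Fin 3) → EuclideanSpace ℝ (Fin 3)} {q₀ : ℝ → EuclideanSpace ℝ (Fin 3) → ℝ}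
    (hv : IsClassicalNSSolutionOn (Icc 0 s) 1 0 v q₀) (hv0 : v 0 = U)
    (hEv : ∃ C : ℝ≥0∞, C < ⊤ ∧ ∀ t ∈ Icc 0 s, ∫⁻ x, ‖v t x‖ₑ ^ 2 ≤ C) :
    ∀ t ∈ Icc 0 s, ∀ x, ‖v t x - w t x‖ ≤ δ := by
  have hsub : Icc 0 s ⊆ Icc 0 T := Icc_subset_Icc le_rfl hsT; have hUs : UniqueDiffOn ℝ (Icc 0 s) := uniqueDiffOn_Icc hs0
  -- ### Tao's class for the free run, with a Tao pressure
  have hdec : HasRapidSpatialDecay U := hasRapidSpatialDecay_of_hasCompactSupport hU hUc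
  have h₀ : ∀ m : ℕ, ∫⁻ x, ‖iteratedFDeriv ℝ m (v 0) x‖ₑ ^ 2 < ⊤ := fun m => by
    rw [hv0]; exact hdec.lintegral_enorm_iteratedFDeriv_sq_lt_top m
  have hEv_nn : ∃ C : ℝ≥0, ∀ t ∈ Icc 0 s, ∫⁻ x, ‖v t x‖ₑ ^ 2 ≤ C := by
    obtain ⟨C, hC, hb⟩ := hEv
    exact ⟨C.toNNReal, fun t ht => (hb t ht).trans (ENNReal.coe_toNNReal hC.ne).ge⟩
  have hvSob : HasBoundedSobolevNormsOn (Icc 0 s) v :=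
    hv.hasBoundedSobolevNormsOn_of_sobolevDatum_unforced one_pos hs0 hEv_nn h₀
  have hHk : IsHkClassicalSolutionOn (Icc 0 s) v q₀ := by
    refine ⟨hv, fun n => ?_⟩
    obtain ⟨C, hC⟩ := hvSob n
    exact ⟨NNReal.sqrt C, fun t ht => eLpNorm_le_sqrt_of_lintegral_sq_le (hC t ht)⟩
  obtain ⟨q, hTao⟩ := hHk.exists_isTaoSolutionOn hs0
  have hv' : IsClassicalNSSolutionOn (Icc 0 s) 1 0 v q := hTao.classical
  -- ### the reference on `[0, s]`
  have hw' : IsClassicalNSSolutionOn (Icc 0 s) 1 r w ϖ := hw.mono hsub hUs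
  have hwS' : HasBoundedSobolevNormsOn (Icc 0 s) w := fun n => (hwS n).imp fun C hC t ht => hC t (hsub ht)
  have hwt' : HasBoundedSobolevNormsOn (Icc 0 s) (FluidPDE.timeDerivWithin (Icc 0 s) w) := by
    intro n
    obtain ⟨C, hC⟩ := hwt n
    refine ⟨C, fun t ht => ?_⟩
    have heq : FluidPDE.timeDerivWithin (Icc 0 s) w t = FluidPDE.timeDerivWithin (Icc 0 T) w t :=
      funext (hw.smooth_velocity.timeDerivWithin_eq_of_subset hsub hUs ht)
    rw [heq]
    exact hC t (hsub ht)
  have hϖS' : ∀ n : ℕ, ∃ C' : ℝ≥0, ∀ t ∈ Icc 0 s, ∫⁻ x, ‖iteratedFDeriv ℝ n (ϖ t) x‖ₑ ^ 2 ≤ C' :=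
    fun n => (hϖS n).imp fun C hC t ht => hC t (hsub ht)
  -- ### the `L²` stage on `[0, s]`: `‖v − w‖₂ ≤ L`
  have hzeroL2 : ∀ t ∈ Icc 0 s,
      ∫⁻ x, ‖(0 : ℝ → EuclideanSpace ℝ (Fin 3) → EuclideanSpace ℝ (Fin 3)) t x‖ₑ ^ 2 < ⊤ := by
    intro t _
    simp
  have hl2 := l2_stability_strain_forced (ν := 1) one_pos hs0 hv' hw' hzeroL2 (fun t ht => hrL2 t (hsub ht))
    hTao.sobolev hTao.sobolev_dt hTao.sobolev_p hwS' hwt' hϖS' (hGc.mono hsub) (hRrc.mono hsub)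
    (fun t ht => hG0 t (hsub ht)) (fun t ht => hRr0 t (hsub ht))
    (fun t ht x ξ => by rw [real_inner_comm]; exact hG t (hsub ht) x ξ)
    (fun t ht => by
      have h := hRr t (hsub ht)
      refine le_trans (le_of_eq (integral_congr_ae (Eventually.of_forall fun x => ?_))) h
      simp only [Pi.zero_apply, zero_sub, norm_neg])
  have hL : ∀ t ∈ Icc 0 s, Real.sqrt (∫ x, ‖(v - w) t x‖ ^ 2) ≤ L t := by
    intro t ht
    have h1 := hl2 t ht
    rw [hv0] at h1
    have hE : Real.sqrt (∫ x, ‖U x - w 0 x‖ ^ 2) ≤ E₀ := by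
      rw [← Real.sqrt_sq hE₀]; exact Real.sqrt_le_sqrt hE0
    have hexp : 0 ≤ Real.exp (∫ τ in (0 : ℝ)..t, G τ) := Real.exp_nonneg _
    have hint : 0 ≤ ∫ τ in (0 : ℝ)..t, Rr τ :=
      intervalIntegral.integral_nonneg ht.1 fun τ hτ => hRr0 τ (hsub ⟨hτ.1, hτ.2.trans ht.2⟩)
    have h2 : (Real.sqrt (∫ x, ‖U x - w 0 x‖ ^ 2) + ∫ τ in (0 : ℝ)..t, Rr τ) * Real.exp (∫ τ in (0 : ℝ)..t, G τ) ≤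
        (E₀ + ∫ τ in (0 : ℝ)..t, Rr τ) * Real.exp (∫ τ in (0 : ℝ)..t, G τ) :=
      mul_le_mul_of_nonneg_right (by linarith) hexp
    have h3 : (fun x => ‖(v - w) t x‖ ^ 2) = fun x => ‖v t x - w t x‖ ^ 2 := by
      funext x; rfl
    rw [h3]; exact h1.trans (h2.trans (hLdef t (hsub ht)))
  -- ### the a-priori `H²` door on `[0, s]`
  have hgD' : ∀ t ∈ Icc 0 s,
      ∫⁻ x, ‖fderiv ℝ ((0 : ℝ → EuclideanSpace ℝ (Fin 3) → EuclideanSpace ℝ (Fin 3)) t) x‖ₑ ^ 2 < ⊤ := by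
    intro t _
    have hz : ∀ x : EuclideanSpace ℝ (Fin 3),
        ‖fderiv ℝ ((0 : ℝ → EuclideanSpace ℝ (Fin 3) → EuclideanSpace ℝ (Fin 3)) t) x‖ₑ ^ 2 = 0 := by
      intro x
      have h0 : fderiv ℝ ((0 : ℝ → EuclideanSpace ℝ (Fin 3) → EuclideanSpace ℝ (Fin 3)) t) x = 0 := by
        change fderiv ℝ (fun _ : EuclideanSpace ℝ (Fin 3) => (0 : EuclideanSpace ℝ (Fin 3))) x = 0
        exact fderiv_const_apply 0
      rw [h0, enorm_eq_nnnorm, nnnorm_zero, ENNReal.coe_zero, zero_pow two_ne_zero]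
    simp_rw [hz, lintegral_zero]; exact ENNReal.zero_lt_top
  have hσ₂0 : ∀ t ∈ Icc 0 T, 0 ≤ σ₂ t := fun t ht => (norm_nonneg _).trans (hσ₂ t ht 0)
  have hσ₃0 : ∀ t ∈ Icc 0 T, 0 ≤ σ₃ t := fun t ht => (norm_nonneg _).trans (hσ₃ t ht 0)
  have hH₁0 : ∀ t ∈ Icc 0 T, 0 ≤ H₁ t := fun t ht => (integral_nonneg fun x => sq_nonneg _).trans (hH₁ t ht)
  have hψ₁0 : ∀ t ∈ Icc 0 T, 0 ≤ ψ₁ t := fun t ht => by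
    refine le_trans ?_ (hψ₁ t ht)
    have : 0 ≤ ∫ x, ‖r t x - (0 : EuclideanSpace ℝ (Fin 3))‖ ^ 2 := integral_nonneg fun x => sq_nonneg _
    have := hσ₂0 t ht
    positivity
  have hη₁0 : 0 ≤ D₁ + Ψ₁ := by
    have h1 : 0 ≤ D₁ := (integral_nonneg fun x => frobeniusNormSq_nonneg _).trans hD₁
    have h2 : 0 ≤ Ψ₁ := (intervalIntegral.integral_nonneg hT.le hψ₁0).trans hΨ₁
    linarith
  have hX₁0 : ∀ t ∈ Icc 0 T, 0 ≤ X₁ t := fun t ht => le_trans (by positivity) (hX₁ t ht)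
  have hψ₂0 : ∀ t ∈ Icc 0 T, 0 ≤ ψ₂ t := fun t ht => by
    refine le_trans ?_ (hψ₂ t ht)
    have := hσ₂0 t ht; have := hσ₃0 t ht; have := hX₁0 t ht; have := hH₁0 t ht
    positivity
  have hΨ₁' : ∫ τ in (0 : ℝ)..s, ψ₁ τ ≤ Ψ₁ := by
    refine le_trans ?_ hΨ₁
    exact intervalIntegral.integral_mono_interval le_rfl hs0.le hsT
      ((ae_restrict_iff' measurableSet_Ioc).2 (Eventually.of_forall fun τ hτ => hψ₁0 τ (Ioc_subset_Icc_self hτ)))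
      (hψ₁c.intervalIntegrable_of_Icc hT.le)
  have hΨ₂' : ∫ τ in (0 : ℝ)..s, ψ₂ τ ≤ Ψ₂ := by
    refine le_trans ?_ hΨ₂
    exact intervalIntegral.integral_mono_interval le_rfl hs0.le hsT
      ((ae_restrict_iff' measurableSet_Ioc).2 (Eventually.of_forall fun τ hτ => hψ₂0 τ (Ioc_subset_Icc_self hτ)))
      (hψ₂c.intervalIntegrable_of_Icc hT.le)
  have hl₁c : ContinuousOn (fun τ => 4 * G τ + 3 * κ * σ₂ τ) (Icc 0 T) :=
    (continuousOn_const.mul hGc).add (continuousOn_const.mul hσ₂c)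
  have hl₁0 : ∀ τ ∈ Icc 0 T, 0 ≤ 4 * G τ + 3 * κ * σ₂ τ := fun τ hτ => by
    have := hG0 τ hτ; have := hσ₂0 τ hτ; positivity
  have hl₂c : ContinuousOn (fun τ => 6 * G τ + 9 * κ * σ₂ τ + 3 * κ ^ 2 * σ₃ τ +
      3 * agmonConst ^ 2 * X₁ τ / (1 * μ) + 27 * agmonConst ^ 4 * X₁ τ ^ 2 / (16 * (1 : ℝ) ^ 3)) (Icc 0 T) := by
    refine ((((continuousOn_const.mul hGc).add (continuousOn_const.mul hσ₂c)).add
      (continuousOn_const.mul hσ₃c)).add ((continuousOn_const.mul hX₁c).div_const _)).add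
      ((continuousOn_const.mul (hX₁c.pow 2)).div_const _)
  have hl₂0 : ∀ τ ∈ Icc 0 T, 0 ≤ 6 * G τ + 9 * κ * σ₂ τ + 3 * κ ^ 2 * σ₃ τ +
      3 * agmonConst ^ 2 * X₁ τ / (1 * μ) + 27 * agmonConst ^ 4 * X₁ τ ^ 2 / (16 * (1 : ℝ) ^ 3) := fun τ hτ => by
    have := hG0 τ hτ; have := hσ₂0 τ hτ; have := hσ₃0 τ hτ; have := hX₁0 τ hτ
    have := agmonConst_nonneg
    positivity
  have hmono₁ : ∫ τ in (0 : ℝ)..s, (4 * G τ + 3 * κ * σ₂ τ) ≤ ∫ τ in (0 : ℝ)..T, (4 * G τ + 3 * κ * σ₂ τ) :=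
    intervalIntegral.integral_mono_interval le_rfl hs0.le hsT
      ((ae_restrict_iff' measurableSet_Ioc).2 (Eventually.of_forall fun τ hτ => hl₁0 τ (Ioc_subset_Icc_self hτ)))
      (hl₁c.intervalIntegrable_of_Icc hT.le)
  have hmono₂ : ∫ τ in (0 : ℝ)..s, (6 * G τ + 9 * κ * σ₂ τ + 3 * κ ^ 2 * σ₃ τ +
      3 * agmonConst ^ 2 * X₁ τ / (1 * μ) + 27 * agmonConst ^ 4 * X₁ τ ^ 2 / (16 * (1 : ℝ) ^ 3)) ≤
      ∫ τ in (0 : ℝ)..T, (6 * G τ + 9 * κ * σ₂ τ + 3 * κ ^ 2 * σ₃ τ +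
      3 * agmonConst ^ 2 * X₁ τ / (1 * μ) + 27 * agmonConst ^ 4 * X₁ τ ^ 2 / (16 * (1 : ℝ) ^ 3)) :=
    intervalIntegral.integral_mono_interval le_rfl hs0.le hsT
      ((ae_restrict_iff' measurableSet_Ioc).2 (Eventually.of_forall fun τ hτ => hl₂0 τ (Ioc_subset_Icc_self hτ)))
      (hl₂c.intervalIntegrable_of_Icc hT.le)
  have hη₂0 : 0 ≤ D₂ + Ψ₂ := by
    have h1 : 0 ≤ D₂ :=
      (Finset.sum_nonneg fun i _ => integral_nonneg fun x => frobeniusNormSq_nonneg _).trans hD₂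
    have h2 : 0 ≤ Ψ₂ := (intervalIntegral.integral_nonneg hT.le hψ₂0).trans hΨ₂
    linarith
  have hhalf₁' : 2 * (agmonConst ^ 4 / (2 * (1 : ℝ) ^ 3) *
      Real.exp (2 * ∫ τ in (0 : ℝ)..s, (4 * G τ + 3 * κ * σ₂ τ))) * (D₁ + Ψ₁) ^ 2 * (s - 0) ≤ 1 / 2 := by
    refine le_trans ?_ hhalf₁
    have hA := agmonConst_nonneg
    have he : Real.exp (2 * ∫ τ in (0 : ℝ)..s, (4 * G τ + 3 * κ * σ₂ τ)) ≤
        Real.exp (2 * ∫ τ in (0 : ℝ)..T, (4 * G τ + 3 * κ * σ₂ τ)) :=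
      Real.exp_le_exp.2 (by linarith)
    have hsq : 0 ≤ (D₁ + Ψ₁) ^ 2 := sq_nonneg _
    calc 2 * (agmonConst ^ 4 / (2 * (1 : ℝ) ^ 3) *
          Real.exp (2 * ∫ τ in (0 : ℝ)..s, (4 * G τ + 3 * κ * σ₂ τ))) * (D₁ + Ψ₁) ^ 2 * (s - 0)
        ≤ 2 * (agmonConst ^ 4 / (2 * (1 : ℝ) ^ 3) *
          Real.exp (2 * ∫ τ in (0 : ℝ)..T, (4 * G τ + 3 * κ * σ₂ τ))) * (D₁ + Ψ₁) ^ 2 * (s - 0) := by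
          gcongr
      _ ≤ 2 * (agmonConst ^ 4 / (2 * (1 : ℝ) ^ 3) *
          Real.exp (2 * ∫ τ in (0 : ℝ)..T, (4 * G τ + 3 * κ * σ₂ τ))) * (D₁ + Ψ₁) ^ 2 * (T - 0) := by
          apply mul_le_mul_of_nonneg_left (by linarith) (by positivity)
  have hhalf₂' : agmonConst ^ 2 * μ / 1 *
      Real.exp (∫ τ in (0 : ℝ)..s, (6 * G τ + 9 * κ * σ₂ τ + 3 * κ ^ 2 * σ₃ τ +
        3 * agmonConst ^ 2 * X₁ τ / (1 * μ) + 27 * agmonConst ^ 4 * X₁ τ ^ 2 / (16 * (1 : ℝ) ^ 3))) *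
      (D₂ + Ψ₂) * (s - 0) ≤ 1 / 2 := by
    refine le_trans ?_ hhalf₂
    have hA := agmonConst_nonneg
    have he := Real.exp_le_exp.2 hmono₂
    calc agmonConst ^ 2 * μ / 1 *
          Real.exp (∫ τ in (0 : ℝ)..s, (6 * G τ + 9 * κ * σ₂ τ + 3 * κ ^ 2 * σ₃ τ +
            3 * agmonConst ^ 2 * X₁ τ / (1 * μ) + 27 * agmonConst ^ 4 * X₁ τ ^ 2 / (16 * (1 : ℝ) ^ 3))) *
          (D₂ + Ψ₂) * (s - 0)
        ≤ agmonConst ^ 2 * μ / 1 *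
          Real.exp (∫ τ in (0 : ℝ)..T, (6 * G τ + 9 * κ * σ₂ τ + 3 * κ ^ 2 * σ₃ τ +
            3 * agmonConst ^ 2 * X₁ τ / (1 * μ) + 27 * agmonConst ^ 4 * X₁ τ ^ 2 / (16 * (1 : ℝ) ^ 3))) *
          (D₂ + Ψ₂) * (s - 0) := by
          have hμ0 : 0 ≤ μ := hμ.le
          gcongr
      _ ≤ _ := by
          apply mul_le_mul_of_nonneg_left (by linarith)
          have hμ0 : 0 ≤ μ := hμ.le
          positivity
  have hvw0 : (v - w) 0 = fun y => U y - w 0 y := by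
    funext y; simp [hv0]
  have hD₁' : ∫ x, frobeniusNormSq (fderiv ℝ ((v - w) 0) x) ≤ D₁ := by rw [hvw0]; exact hD₁
  have hD₂' : (∑ i, ∫ x, frobeniusNormSq (fderiv ℝ (fun y => fderiv ℝ ((v - w) 0) y
      (EuclideanSpace.basisFun (Fin 3) ℝ i)) x)) ≤ D₂ := by rw [hvw0]; exact hD₂
  intro t ht x
  have hmain := classicalNS_norm_sub_le_strain_window_half_R3 (ν := (1 : ℝ)) one_pos hs0 hv' hw'
    hwS' hwt' hϖS' hTao.sobolev hTao.sobolev_dt hTao.sobolev_p (fun τ hτ => hrD τ (hsub hτ)) hgD' hκ hμ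
    (fun τ hτ => hG τ (hsub hτ)) (fun τ hτ => hσ₂ τ (hsub hτ)) (fun τ hτ => hσ₃ τ (hsub hτ)) hL
    (fun τ hτ => hH₁ τ (hsub hτ)) (fun τ hτ => hψ₁ τ (hsub hτ)) (fun τ hτ => hψ₂ τ (hsub hτ))
    (hGc.mono hsub) (hσ₂c.mono hsub) (hσ₃c.mono hsub) (hLc.mono hsub) (hX₁c.mono hsub) (hH₁c.mono hsub)
    (hψ₁c.mono hsub) (hψ₂c.mono hsub) hD₁' hΨ₁' hD₂' hΨ₂' hhalf₁' (fun τ hτ => hX₁ τ (hsub hτ)) hhalf₂' ht x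
  exact hmain.trans (hδ t (hsub ht))

/-- The zero force is smooth on the closed half-space. [cite: FeffermanClay2006, (5) (6)] -/
private theorem isSmoothOnHalfSpace_zero_force :
    IsSmoothOnHalfSpace (0 : ℝ → EuclideanSpace ℝ (Fin 3) → EuclideanSpace ℝ (Fin 3)) := by
  have h : uncurry (0 : ℝ → EuclideanSpace ℝ (Fin 3) → EuclideanSpace ℝ (Fin 3)) = fun _ => 0 := by
    funext q; rfl
  rw [IsSmoothOnHalfSpace, h]
  exact contDiffOn_const

/-- The zero force has Fefferman's space-time decay (5). [cite: FeffermanClay2006, (5) (6)] -/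
private theorem hasRapidSpaceTimeDecay_zero_force :
    HasRapidSpaceTimeDecay (0 : ℝ → EuclideanSpace ℝ (Fin 3) → EuclideanSpace ℝ (Fin 3)) := by
  intro n K
  have h : uncurry (0 : ℝ → EuclideanSpace ℝ (Fin 3) → EuclideanSpace ℝ (Fin 3)) = 0 := by
    funext q; rfl
  refine ⟨0, fun t _ x => ?_⟩
  rw [h, iteratedFDerivWithin_zero]
  simp

/-- **THE STRAIN-SHADOWED RUN IN `H²` CURRENCY (existence and sup-closeness, route (B)).** Under the hypotheses of
`freeRun_near_of_strainH2` plus divergence-freeness of the datum and a speed bound `‖w‖ ≤ B_w` of the reference, the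
free classical finite-energy run `v` from `v(0) = U` EXISTS on `[0, T] × ℝ³` and `‖v − w‖ ≤ δ` there (every free run
on a sub-slab is bounded by `B_w + δ` by the a-priori half; `ClayEvolution.exists_classical_Icc_of_apriori_bound`).
[cite: RobinsonRodrigoSadowskiCUP2016, Thm 9.1 and Thm 1.20] [cite: DashtiRobinson2008, Thm 1, Thm 2]
[cite: Tao2011, Thm. 5.4 (ii)+(iv)] -/
theorem exists_freeRun_near_of_strainH2 (hT : 0 < T)
    (hw : IsClassicalNSSolutionOn (Icc 0 T) 1 r w ϖ)
    (hwS : HasBoundedSobolevNormsOn (Icc 0 T) w)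
    (hwt : HasBoundedSobolevNormsOn (Icc 0 T) (FluidPDE.timeDerivWithin (Icc 0 T) w))
    (hϖS : ∀ n : ℕ, ∃ C' : ℝ≥0, ∀ t ∈ Icc 0 T, ∫⁻ x, ‖iteratedFDeriv ℝ n (ϖ t) x‖ₑ ^ 2 ≤ C')
    (hrL2 : ∀ t ∈ Icc 0 T, ∫⁻ x, ‖r t x‖ₑ ^ 2 < ⊤)
    (hrD : ∀ t ∈ Icc 0 T, ∫⁻ x, ‖fderiv ℝ (r t) x‖ₑ ^ 2 < ⊤)
    (hbw : ∀ t ∈ Icc 0 T, ∀ y, ‖w t y‖ ≤ Bw)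
    (hκ : 0 < κ) (hμ : 0 < μ)
    (hG : ∀ s ∈ Icc 0 T, ∀ (x ξ : EuclideanSpace ℝ (Fin 3)), -⟪fderiv ℝ (w s) x ξ, ξ⟫ ≤ G s * ‖ξ‖ ^ 2)
    (hG0 : ∀ s ∈ Icc 0 T, 0 ≤ G s)
    (hσ₂ : ∀ s ∈ Icc 0 T, ∀ x, ‖iteratedFDeriv ℝ 2 (w s) x‖ ≤ σ₂ s)
    (hσ₃ : ∀ s ∈ Icc 0 T, ∀ x, ‖iteratedFDeriv ℝ 3 (w s) x‖ ≤ σ₃ s)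
    (hRr0 : ∀ s ∈ Icc 0 T, 0 ≤ Rr s) (hRr : ∀ s ∈ Icc 0 T, ∫ x, ‖r s x‖ ^ 2 ≤ Rr s ^ 2)
    (hLdef : ∀ s ∈ Icc 0 T, (E₀ + ∫ τ in (0 : ℝ)..s, Rr τ) * Real.exp (∫ τ in (0 : ℝ)..s, G τ) ≤ L s)
    (hH₁ : ∀ s ∈ Icc 0 T, ∫ x, ‖fderiv ℝ (fun y => r s y - (0 : EuclideanSpace ℝ (Fin 3))) x‖ ^ 2 ≤ H₁ s)
    (hψ₁ : ∀ s ∈ Icc 0 T, 2 / 1 * (∫ x, ‖r s x - (0 : EuclideanSpace ℝ (Fin 3))‖ ^ 2) +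
      3 * σ₂ s / κ * L s ^ 2 ≤ ψ₁ s)
    (hψ₂ : ∀ s ∈ Icc 0 T, 27 * σ₂ s / κ * X₁ s + 9 * σ₃ s / κ ^ 2 * L s ^ 2 + 6 / 1 * H₁ s ≤ ψ₂ s)
    (hGc : ContinuousOn G (Icc 0 T)) (hσ₂c : ContinuousOn σ₂ (Icc 0 T)) (hσ₃c : ContinuousOn σ₃ (Icc 0 T))
    (hRrc : ContinuousOn Rr (Icc 0 T)) (hLc : ContinuousOn L (Icc 0 T)) (hX₁c : ContinuousOn X₁ (Icc 0 T))
    (hH₁c : ContinuousOn H₁ (Icc 0 T)) (hψ₁c : ContinuousOn ψ₁ (Icc 0 T)) (hψ₂c : ContinuousOn ψ₂ (Icc 0 T))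
    (hU : ContDiff ℝ ∞ U) (hUc : HasCompactSupport U) (hUdiv : VectorCalculus.IsDivFree U)
    (hE₀ : 0 ≤ E₀) (hE0 : ∫ x, ‖U x - w 0 x‖ ^ 2 ≤ E₀ ^ 2)
    (hD₁ : ∫ x, frobeniusNormSq (fderiv ℝ (fun y => U y - w 0 y) x) ≤ D₁)
    (hD₂ : (∑ i, ∫ x, frobeniusNormSq (fderiv ℝ (fun y => fderiv ℝ (fun z => U z - w 0 z) y
      (EuclideanSpace.basisFun (Fin 3) ℝ i)) x)) ≤ D₂)
    (hΨ₁ : ∫ s in (0 : ℝ)..T, ψ₁ s ≤ Ψ₁) (hΨ₂ : ∫ s in (0 : ℝ)..T, ψ₂ s ≤ Ψ₂)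
    (hhalf₁ : 2 * (agmonConst ^ 4 / (2 * (1 : ℝ) ^ 3) *
        Real.exp (2 * ∫ s in (0 : ℝ)..T, (4 * G s + 3 * κ * σ₂ s))) * (D₁ + Ψ₁) ^ 2 * (T - 0) ≤ 1 / 2)
    (hX₁ : ∀ s ∈ Icc 0 T,
      Real.sqrt 2 * (Real.exp (∫ τ in (0 : ℝ)..s, (4 * G τ + 3 * κ * σ₂ τ)) * (D₁ + Ψ₁)) ≤ X₁ s)
    (hhalf₂ : agmonConst ^ 2 * μ / 1 *
        Real.exp (∫ s in (0 : ℝ)..T, (6 * G s + 9 * κ * σ₂ s + 3 * κ ^ 2 * σ₃ s +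
          3 * agmonConst ^ 2 * X₁ s / (1 * μ) + 27 * agmonConst ^ 4 * X₁ s ^ 2 / (16 * (1 : ℝ) ^ 3))) *
      (D₂ + Ψ₂) * (T - 0) ≤ 1 / 2)
    (hδ : ∀ t ∈ Icc 0 T, agmonConst * (3 * X₁ t *
      (2 * (Real.exp (∫ s in (0 : ℝ)..t, (6 * G s + 9 * κ * σ₂ s + 3 * κ ^ 2 * σ₃ s +
          3 * agmonConst ^ 2 * X₁ s / (1 * μ) + 27 * agmonConst ^ 4 * X₁ s ^ 2 / (16 * (1 : ℝ) ^ 3))) *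
        (D₂ + Ψ₂)))) ^ (1 / 4 : ℝ) ≤ δ) :
    ∃ (v : ℝ → EuclideanSpace ℝ (Fin 3) → EuclideanSpace ℝ (Fin 3))
      (q : ℝ → EuclideanSpace ℝ (Fin 3) → ℝ),
      IsClassicalNSSolutionOn (Icc 0 T) 1 0 v q ∧ v 0 = U ∧
      (∃ C : ℝ≥0∞, C < ⊤ ∧ ∀ t ∈ Icc 0 T, ∫⁻ x, ‖v t x‖ₑ ^ 2 ≤ C) ∧
      ∀ t ∈ Icc 0 T, ∀ x, ‖v t x - w t x‖ ≤ δ := by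
  have hdec : HasRapidSpatialDecay U := hasRapidSpatialDecay_of_hasCompactSupport hU hUc
  have hapriori : ∀ T' ∈ Ioc 0 T,
      ∀ (u : ℝ → EuclideanSpace ℝ (Fin 3) → EuclideanSpace ℝ (Fin 3))
        (p : ℝ → EuclideanSpace ℝ (Fin 3) → ℝ),
        IsClassicalNSSolutionOn (Icc 0 T') 1 0 u p → u 0 = U →
        (∃ C : ℝ≥0∞, C < ⊤ ∧ ∀ t ∈ Icc 0 T', ∫⁻ x, ‖u t x‖ₑ ^ 2 ≤ C) →
        ∀ t ∈ Icc 0 T', ∀ x, ‖u t x‖ ≤ Bw + δ := by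
    intro T' hT' u p hcl h0 hE t ht x
    have hnear := freeRun_near_of_strainH2 hT hw hwS hwt hϖS hrL2 hrD hκ hμ hG hG0 hσ₂ hσ₃ hRr0 hRr hLdef hH₁
      hψ₁ hψ₂ hGc hσ₂c hσ₃c hRrc hLc hX₁c hH₁c hψ₁c hψ₂c hU hUc hE₀ hE0 hD₁ hD₂ hΨ₁ hΨ₂ hhalf₁ hX₁ hhalf₂ hδ
      hT'.1 hT'.2 hcl h0 hE t ht x
    have hwb := hbw t ⟨ht.1, ht.2.trans hT'.2⟩ x
    calc ‖u t x‖ = ‖w t x + (u t x - w t x)‖ := by rw [add_sub_cancel]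
      _ ≤ ‖w t x‖ + ‖u t x - w t x‖ := norm_add_le _ _
      _ ≤ Bw + δ := add_le_add hwb hnear
  obtain ⟨v, q, hcl, hv0, hEv, -⟩ :=
    ClayEvolution.exists_classical_Icc_of_apriori_bound one_pos hU (fun x => hUdiv x) hdec
      isSmoothOnHalfSpace_zero_force hasRapidSpaceTimeDecay_zero_force hT hapriori
  exact ⟨v, q, hcl, hv0, hEv, fun t ht x =>
    freeRun_near_of_strainH2 hT hw hwS hwt hϖS hrL2 hrD hκ hμ hG hG0 hσ₂ hσ₃ hRr0 hRr hLdef hH₁ hψ₁ hψ₂ hGc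
      hσ₂c hσ₃c hRrc hLc hX₁c hH₁c hψ₁c hψ₂c hU hUc hE₀ hE0 hD₁ hD₂ hΨ₁ hΨ₂ hhalf₁ hX₁ hhalf₂ hδ hT le_rfl hcl
      hv0 hEv t ht x⟩

end Main

end Summit.NavierStokesRegularity.FluidComputer.PalasekTowerClayBridge.StrainShadowH2

end
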